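import Summits.Ventures.Crystal3D.Theorems.StickyWulffConstantCoaxialWallLawSeamEndPools
import HarnessLib

/-!
# The COHERENT / INCOHERENT split of the seam residual by CAPPING CLOSURE (crux `CoaxialWallLaw`, stmt-Ventures-19481; line `WallLedgerF`,
# skeleton 'CoaxialWallLawCertificates' v7; 19481-p2 g11 14:21Z proposal for v8)

HONEST FRAMING. Venture `Summits/Ventures/Crystal3D` (cell `crystal3d-full`); DEFINITIONS + one composition for the crux `CoaxialWallLaw` (stmt-Ventures-19481,
`route-Ventures-StickyWulffConstant`), line 'Certificates' v7 (stub `stub_motifFreeEndPools`).  Nothing is claimed; F-C1 not moved.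
WHY (19481-p1's (R0) runs, 14:19Z): motif-free residual windows exist and are COHERENT (direct Σ9/CSL contact boundaries without a twin lamella: no twin reader,
min pooledDef/endMultA = 4.25; facet 2-fans: 9), while thin lamellae are mono-module.  A reader-based motif list cannot separate «certificate matter» (coherent
junctions, a finite growth enumeration) from «sparsity matter» (incoherent grains, HEAL-CAP).  The dividing line that does is the CAPPING CLOSURE of the module
sites — every ball of a twin-word grain sits in the hollow of three already generated balls, and a foreign ball at a TIP of a generated facet ball would itself be
generated (`…HealCap`):
* `CapsTriangleIn T x` — `x` touches three pairwise touching points of `T`;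
* `CoherentAt X z` — for some placement `S` (payer to `0`) the balls within `3` of `z` admit a DERIVATION ORDER in which every ball is a module site of `siteBall`
  or caps a unit triangle of EARLIER balls (so the coherent windows over a payer form a finite growth tree from the sites: the certificate universe);
* `CoherentSeamSmall s k₀` — residual-payer hypotheses ∧ `CoherentAt` ⇒ deletion on-site ∨ joint summand `≤ s` (CERTIFICATE, objective `Σ_A` itself; subsumes the
  Σ9-pair motif AND the direct CSL boundaries of (R0));
* `IncoherentEndPools p₀ k₀` — residual-payer hypotheses ∧ `¬ CoherentAt` ⇒ deletion on-site ∨ `p₀ · endMultA b ≤ pooledDef b` for every `b` within `1` (ANALYTIC: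
  a non-derivable ball caps no triangle of derived balls, so its contacts onto derived `{111}`-facet balls are off-tip, `≤ 2` each by `card_offTip_contacts_le_two`);
* `localSummandA_le_of_pools` — the pointwise end-pool bound (`≤ 12` loaded balls, each `≤ 1/p₀`);
* **`seamResidual_of_coherent_of_incoherent`** — `CoherentSeamSmall (2·√6) k₀ → IncoherentEndPools p₀ k₀ → √6 ≤ p₀ → SeamResidual (2·√6) k₀` (sound by excluded
  middle on `CoherentAt`; no motif list, no dichotomy needed).
WHAT THIS IS NOT: neither input is proved or claimed; whether v8 adopts this split is cf-p1's decision; F-C1 not moved.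
-/

noncomputable section

namespace Summit.Ventures.Crystal3D.Theorems

namespace TailResidue

open Summit.Ventures.Crystal3D Finset
open scoped InnerProductSpace

/-- `x` CAPS A UNIT TRIANGLE of `T`: three pairwise touching points of `T`, each touching `x`. -/
def CapsTriangleIn (T : Finset (EuclideanSpace ℝ (Fin 3))) (x : EuclideanSpace ℝ (Fin 3)) : Prop :=
  ∃ a ∈ T, ∃ b ∈ T, ∃ c ∈ T, dist a b = 1 ∧ dist a c = 1 ∧ dist b c = 1 ∧ dist x a = 1 ∧ dist x b = 1 ∧ dist x c = 1

/-- **COHERENT WINDOW (capping closure)**: for some placement `S` (payer `z ↦ 0`) the balls of `X` within `3` of `z` can be listed so that every ball is a MODULE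
SITE of the placement (`modSite` of `siteBall`, transported) or caps a unit triangle of balls EARLIER in the list.  Twin-word grains anchored inside the window
(coherent twins, Σ9 reader pairs, direct Σ9/Σ27 contact boundaries, lamellae, facet fans) are coherent — derive inward: a ball of a close-packed grain caps a
triangle of its own dozen on the side of the payer, a grain in coherent contact caps triangles of the grain it rests on; a grain at a generic offset is not.
The analytic side should work with the capping CLOSURE `D` of the site balls inside the window (a valid list prefix; by maximality no ball outside `D` caps a
triangle of `D`, so its contacts onto `D`-facet balls are off-tip). -/
def CoherentAt (X : Finset (EuclideanSpace ℝ (Fin 3))) (z : EuclideanSpace ℝ (Fin 3)) : Prop :=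
  ∃ S : EuclideanSpace ℝ (Fin 3) ≃ₗᵢ[ℝ] EuclideanSpace ℝ (Fin 3), ∃ l : List (EuclideanSpace ℝ (Fin 3)),
    (∀ x, x ∈ l ↔ x ∈ X ∧ dist z x ≤ 3) ∧
    ∀ i : Fin l.length, S.symm (l.get i) + -S.symm z ∈ modSite '' (↑siteBall : Set (ℤ × ℤ × ℤ)) ∨ CapsTriangleIn (l.take i).toFinset (l.get i)

open scoped Classical in
/-- **COHERENT SEAM SMALLNESS at the line `s` (named input; CERTIFICATE)**: at a residual payer window (`1`-separated, `deg z ≤ 11`, off-site for 𝒰_cx, not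
mono-module for `L`, `k₀ < deg z`, not jammed-one) that is COHERENT, a deletion of inessential balls lands on-site or the joint summand of `L` is `≤ s`. -/
def CoherentSeamSmall (s : ℝ) (k₀ : ℕ) : Prop :=
  ∀ L : EuclideanSpace ℝ (Fin 3) ≃ₗᵢ[ℝ] EuclideanSpace ℝ (Fin 3),
  ∀ X : Finset (EuclideanSpace ℝ (Fin 3)), (∀ p ∈ X, ∀ q ∈ X, p ≠ q → 1 ≤ dist p q) →
  ∀ z ∈ X, (X.filter fun q => dist z q = 1).card ≤ 11 → ¬ OnSiteAt coaxialModuleUniverse X z → ¬ MonoModuleAt L X z →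
    k₀ < (X.filter fun q => dist z q = 1).card → ¬ JammedOneAt X z → CoherentAt X z →
    HasDeletionOnSite X z ∨
      localSummandA WordVersion.v2 (basalSystem L)
        (basalSystem (((ℝ ∙ EuclideanSpace.single (2 : Fin 3) (1 : ℝ)).reflection).trans L)) X z ≤ s

open scoped Classical in
/-- **INCOHERENT END POOLS at ratio `p₀` (named input; ANALYTIC)**: at a residual payer window that is NOT coherent, a deletion lands on-site or every ball `b`
within `1` of the payer has `p₀ · endMultA b ≤ pooledDef b` (v2, clause (A), joint basal systems of `L`). -/
def IncoherentEndPools (p₀ : ℝ) (k₀ : ℕ) : Prop :=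
  ∀ L : EuclideanSpace ℝ (Fin 3) ≃ₗᵢ[ℝ] EuclideanSpace ℝ (Fin 3),
  ∀ X : Finset (EuclideanSpace ℝ (Fin 3)), (∀ p ∈ X, ∀ q ∈ X, p ≠ q → 1 ≤ dist p q) →
  ∀ z ∈ X, (X.filter fun q => dist z q = 1).card ≤ 11 → ¬ OnSiteAt coaxialModuleUniverse X z → ¬ MonoModuleAt L X z →
    k₀ < (X.filter fun q => dist z q = 1).card → ¬ JammedOneAt X z → ¬ CoherentAt X z →
    HasDeletionOnSite X z ∨
      ∀ b ∈ X, dist z b ≤ 1 →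
        p₀ * (endMultA X WordVersion.v2 (basalSystem L) (basalSystem (((ℝ ∙ EuclideanSpace.single (2 : Fin 3) (1 : ℝ)).reflection).trans L)) b : ℝ) ≤
          pooledDef X b

open scoped Classical in
/-- **The pointwise end-pool bound**: if every ball within `1` of a ball `z` of a `1`-separated configuration (`deg z ≤ 11`) has `p₀ · e(b) ≤ p(b)` with
`√6 ≤ p₀`, the joint (A)-summand at `z` is `≤ 2√6` (at most `12` loaded balls, each contributing `≤ 1/p₀`). -/
theorem localSummandA_le_of_pools {X : Finset (EuclideanSpace ℝ (Fin 3))} (hX : ∀ p ∈ X, ∀ q ∈ X, p ≠ q → 1 ≤ dist p q)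
    {z : EuclideanSpace ℝ (Fin 3)} (hz : z ∈ X) (hdeg : (X.filter fun q => dist z q = 1).card ≤ 11) (S₁ S₂ : PlateSystem) {p₀ : ℝ}
    (hp₀ : Real.sqrt 6 ≤ p₀) (hpool : ∀ b ∈ X, dist z b ≤ 1 → p₀ * (endMultA X WordVersion.v2 S₁ S₂ b : ℝ) ≤ pooledDef X b) :
    localSummandA WordVersion.v2 S₁ S₂ X z ≤ 2 * Real.sqrt 6 := by
  have h6 : 0 < Real.sqrt 6 := Real.sqrt_pos.2 (by norm_num)
  have hp : 0 < p₀ := lt_of_lt_of_le h6 hp₀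
  unfold localSummandA
  set A := X.filter (fun b => dist z b ≤ 1 ∧ 0 < endMultA X WordVersion.v2 S₁ S₂ b) with hA
  have hterm : ∀ b ∈ A, (endMultA X WordVersion.v2 S₁ S₂ b : ℝ) / pooledDef X b ≤ 1 / p₀ := by
    intro b hb
    obtain ⟨hbX, hzb, hepos⟩ := mem_filter.1 hb
    have hle := hpool b hbX hzb
    have he : (0 : ℝ) < (endMultA X WordVersion.v2 S₁ S₂ b : ℝ) := by exact_mod_cast hepos
    have hP : 0 < pooledDef X b := lt_of_lt_of_le (mul_pos hp he) hle
    rw [div_le_div_iff₀ hP hp, one_mul, mul_comm]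
    exact hle
  have hcard : (A.card : ℝ) ≤ 12 := by
    have h1 : A.card ≤ (X.filter fun b => dist z b ≤ 1).card := card_le_card fun b hb => mem_filter.2 ⟨(mem_filter.1 hb).1, (mem_filter.1 hb).2.1⟩
    have h2 := card_closedBall_one_le hX hz
    have : A.card ≤ 12 := by omega
    exact_mod_cast this
  calc ∑ b ∈ A, (endMultA X WordVersion.v2 S₁ S₂ b : ℝ) / pooledDef X b ≤ ∑ b ∈ A, 1 / p₀ := sum_le_sum hterm
    _ = A.card * (1 / p₀) := by rw [sum_const, nsmul_eq_mul]
    _ ≤ 12 * (1 / p₀) := by gcongr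
    _ ≤ 12 * (1 / Real.sqrt 6) := by gcongr
    _ = 2 * Real.sqrt 6 := by
        have h : Real.sqrt 6 * Real.sqrt 6 = 6 := Real.mul_self_sqrt (by norm_num)
        field_simp
        linarith

/-- Monotonicity of the coherent input. -/
theorem coherentSeamSmall_mono {s s' : ℝ} {k₀ k₁ : ℕ} (h : CoherentSeamSmall s k₀) (hs : s ≤ s') (hk : k₀ ≤ k₁) : CoherentSeamSmall s' k₁ := by
  intro L X hX z hz hdeg hoff hM hk' hJ hco
  rcases h L X hX z hz hdeg hoff hM (lt_of_le_of_lt hk hk') hJ hco with hdel | hle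
  · exact Or.inl hdel
  · exact Or.inr (hle.trans hs)

/-- Monotonicity of the incoherent input. -/
theorem incoherentEndPools_mono {p₀ p₁ : ℝ} {k₀ k₁ : ℕ} (h : IncoherentEndPools p₁ k₀) (hp : p₀ ≤ p₁) (hk : k₀ ≤ k₁) : IncoherentEndPools p₀ k₁ := by
  intro L X hX z hz hdeg hoff hM hk' hJ hco
  rcases h L X hX z hz hdeg hoff hM (lt_of_le_of_lt hk hk') hJ hco with hdel | hpool
  · exact Or.inl hdel
  · refine Or.inr fun b hb hzb => le_trans ?_ (hpool b hb hzb)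
    exact mul_le_mul_of_nonneg_right hp (Nat.cast_nonneg _)

/-- **THE v8 DERIVATION of `stub_seamResidual` (proposal)**: the coherent certificate and the incoherent end pools settle the seam residual — no motif list, no
dichotomy; the case split is excluded middle on `CoherentAt`. -/
theorem seamResidual_of_coherent_of_incoherent {p₀ : ℝ} {k₀ : ℕ} (hco : CoherentSeamSmall (2 * Real.sqrt 6) k₀) (hinc : IncoherentEndPools p₀ k₀)
    (hp₀ : Real.sqrt 6 ≤ p₀) : SeamResidual (2 * Real.sqrt 6) k₀ := by
  intro L X hX z hz hdeg hoff hM hk hJ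
  by_cases hc : CoherentAt X z
  · exact hco L X hX z hz hdeg hoff hM hk hJ hc
  · rcases hinc L X hX z hz hdeg hoff hM hk hJ hc with hdel | hpool
    · exact Or.inl hdel
    · exact Or.inr (localSummandA_le_of_pools hX hz hdeg _ _ hp₀ hpool)

/-- The same with the stub's kissing binders in front (the shape a lane-F derived stub expects). -/
theorem seamResidual_of_coherent_of_incoherent' (hco : CoherentSeamSmall (2 * Real.sqrt 6) 3) (hinc : IncoherentEndPools (Real.sqrt 6) 3) :
    KissingGap (5 / 2) → KissingClassification (5 / 2) → SeamResidual (2 * Real.sqrt 6) 3 :=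
  fun _ _ => seamResidual_of_coherent_of_incoherent hco hinc le_rfl

/-! ### Σ-form of the incoherent side (appended; v8.1) -/

open scoped Classical in
/-- **INCOHERENT SEAM SMALLNESS at the line `s` (named input; ANALYTIC, Σ-form — the v8.1 shape of the incoherent stub)**: at a residual payer window that is
NOT coherent, a deletion of inessential balls lands on-site or the joint summand of `L` is `≤ s`.  (The per-ball form `IncoherentEndPools` is stronger and at
risk under erosion of a coherent core by quiet junk; this Σ-form is what the comparison `…SeamCoreSplit.localSummandA_le_core_add_seam` + an erosion-aware
coherent certificate + seam sparsity prove.) -/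
def IncoherentSeamSmall (s : ℝ) (k₀ : ℕ) : Prop :=
  ∀ L : EuclideanSpace ℝ (Fin 3) ≃ₗᵢ[ℝ] EuclideanSpace ℝ (Fin 3),
  ∀ X : Finset (EuclideanSpace ℝ (Fin 3)), (∀ p ∈ X, ∀ q ∈ X, p ≠ q → 1 ≤ dist p q) →
  ∀ z ∈ X, (X.filter fun q => dist z q = 1).card ≤ 11 → ¬ OnSiteAt coaxialModuleUniverse X z → ¬ MonoModuleAt L X z →
    k₀ < (X.filter fun q => dist z q = 1).card → ¬ JammedOneAt X z → ¬ CoherentAt X z →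
    HasDeletionOnSite X z ∨
      localSummandA WordVersion.v2 (basalSystem L)
        (basalSystem (((ℝ ∙ EuclideanSpace.single (2 : Fin 3) (1 : ℝ)).reflection).trans L)) X z ≤ s

/-- Monotonicity of the Σ-form incoherent input. -/
theorem incoherentSeamSmall_mono {s s' : ℝ} {k₀ k₁ : ℕ} (h : IncoherentSeamSmall s k₀) (hs : s ≤ s') (hk : k₀ ≤ k₁) : IncoherentSeamSmall s' k₁ := by
  intro L X hX z hz hdeg hoff hM hk' hJ hco
  rcases h L X hX z hz hdeg hoff hM (lt_of_le_of_lt hk hk') hJ hco with hdel | hle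
  · exact Or.inl hdel
  · exact Or.inr (hle.trans hs)

/-- The per-ball incoherent input implies the Σ-form at the line `2√6` (nothing typed against v8 is lost). -/
theorem incoherentSeamSmall_of_endPools {p₀ : ℝ} {k₀ : ℕ} (h : IncoherentEndPools p₀ k₀) (hp₀ : Real.sqrt 6 ≤ p₀) :
    IncoherentSeamSmall (2 * Real.sqrt 6) k₀ := by
  intro L X hX z hz hdeg hoff hM hk hJ hco
  rcases h L X hX z hz hdeg hoff hM hk hJ hco with hdel | hpool
  · exact Or.inl hdel
  · exact Or.inr (localSummandA_le_of_pools hX hz hdeg _ _ hp₀ hpool)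

/-- **THE v8.1 DERIVATION of `stub_seamResidual`**: coherent certificate and incoherent Σ-bound at the same line `s` settle `SeamResidual s k₀` (cases on
`CoherentAt`). -/
theorem seamResidual_of_coherentSmall_of_incoherentSmall {s : ℝ} {k₀ : ℕ} (hco : CoherentSeamSmall s k₀) (hinc : IncoherentSeamSmall s k₀) :
    SeamResidual s k₀ := by
  intro L X hX z hz hdeg hoff hM hk hJ
  by_cases hc : CoherentAt X z
  · exact hco L X hX z hz hdeg hoff hM hk hJ hc
  · exact hinc L X hX z hz hdeg hoff hM hk hJ hc

/-- The same with the stub's kissing binders in front, at `s = 2√6`, `k₀ = 3`. -/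
theorem seamResidual_of_coherentSmall_of_incoherentSmall' (hco : CoherentSeamSmall (2 * Real.sqrt 6) 3) (hinc : IncoherentSeamSmall (2 * Real.sqrt 6) 3) :
    KissingGap (5 / 2) → KissingClassification (5 / 2) → SeamResidual (2 * Real.sqrt 6) 3 :=
  fun _ _ => seamResidual_of_coherentSmall_of_incoherentSmall hco hinc

end TailResidue

end Summit.Ventures.Crystal3D.Theorems

end
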